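import Mathlib.NumberTheory.LSeries.DirichletContinuation
import HarnessLib

/-!
# Zeros of linear combinations of Dirichlet `L`-functions (Saias–Weingartner 2009, Theorem 2)

Topic `Literature/NumberTheory/LFunctions` (namespace `Literature.NumberTheory.LFunctions`).

Saias–Weingartner, *Zeros of Dirichlet series with periodic coefficients*, Acta Arith. 140 (2009),
**Theorem 2**: "Let `C` be a finite set of at least two primitive Dirichlet characters, and let
`(P_ψ)_{ψ ∈ C}` be a family of non-zero Dirichlet polynomials. Define `F(s) := ∑_{ψ ∈ C} P_ψ(s)
L_ψ(s)`. Then there exists a number `η = η(F) > 0` such that, for all real numbers `σ₁` and `σ₂`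
with `1/2 ≤ σ₁ < σ₂ ≤ 1 + η` and all sufficiently large `T`, we have
`N'_F(σ₁, σ₂, T) ≫_{F,σ₁,σ₂} T`", `N'_F(σ₁, σ₂, T)` counting the zeros of `F` in
`σ₁ < Re s < σ₂`, `|Im s| ≤ T` without multiplicity. The whole theorem is vendored (as the named
fact `Literature.Barriers.RiemannHypothesis.SaiasWeingartner`) in the barrier catalogue file
`Literature/Barriers/RiemannHypothesis/DavenportHeilbronn.lean`; this file carries its
DECOMPOSITION along the first sentence of the printed proof (§4): "If `σ₁ < 1` then
`N'_F(σ₁, σ₂, T) ≫ T` by Theorem 2 of [KK07]. We may thus restrict our attention to the case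
`σ₁ ≥ 1`."

* `HasLinearlyManyZeros F σ₁ σ₂` — "`N'_F(σ₁, σ₂, T) ≫ T` for all sufficiently large `T`",
  witnessed by finite sets of at least `cT` zeros of `F` in the rectangle (the rendering used in
  `SaiasWeingartner`);
* `charCombination χ P` — `F(s) = ∑ᵢ Pᵢ(s) L(s, χᵢ)` with `Pᵢ(s) = LSeries (P i) s` a Dirichlet
  polynomial (finitely supported coefficients) and `L(s, χᵢ)` Mathlib's
  `DirichletCharacter.LFunction`;
* `IsSWFamily χ P` — the hypotheses of Theorem 2: at least two indices, each `χ i` primitive, the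
  pairs `⟨q i, χ i⟩` pairwise distinct, each `P i` finitely supported with a non-zero coefficient
  at some `n ≥ 1`;
* ONE NAMED FACT, the new part of the paper: `SaiasWeingartner2009_thm2_right` (§4: there is
  `η = η(F) > 0` covering all strips with `1 ≤ σ₁ < σ₂ ≤ 1 + η`);
* the case `σ₁ < 1` ("Theorem 2 of [KK07]"; strips with `1/2 ≤ σ₁ < σ₂ ≤ 1`) is NOT a named fact
  of this file: it is PROVED, from the hybrid joint universality theorem on discs
  (`Pankowski2010_thm1_1_discAnalytic` of `HybridJointUniversality.lean`, [Pankowski2010],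
  Thm. 1.1 and Cor. 5.3), as `SaiasWeingartner2009_thm2_left_of_pankowski` in
  `SaiasWeingartnerLeftProofs.lean`, which also assembles Theorem 2 in full
  (`saiasWeingartner_thm2_of_pankowski`) and feeds the barrier bridge
  `Literature.Barriers.RiemannHypothesis.SaiasWeingartner_of_pankowski`. (D-0026 split review,
  2026-08-15: the earlier named fact `SaiasWeingartner2009_thm2_left`, p23235, once reduced to
  `Pankowski2010_thm1_1_discAnalytic`, carried no obligation of its own and was merged back into
  the parent's proof obligation; its statement survives verbatim as the conclusion of that
  theorem.)
* PROVED: monotonicity of `HasLinearlyManyZeros` in the strip, its derivation from zeros in discs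
  `|Re s − σ| < r`, and the glue `saiasWeingartner_thm2_of_halves` of the two cases of §4's first
  sentence into the printed range `1/2 ≤ σ₁ < σ₂ ≤ 1 + η` (the strip `σ₁ < 1 < σ₂` contains the
  strip `(σ₁, min(σ₂, 1))`), stated for an arbitrary function `F`.

## References

* [SaiasWeingartner2009] E. Saias, A. Weingartner, Acta Arith. 140 (2009), 335–344, Theorem 2 and
  §4. Read (arXiv:0807.0783, pp. 1–8).
* [KaczorowskiKulas2006] J. Kaczorowski, M. Kulas, Monatsh. Math. 150 (2007), 217–232 (online
  2006), Theorem 2 (not held; quoted through [SaiasWeingartner2009], §1 and §4, and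
  [Pankowski2010], p. 60 and Cor. 5.3).
* [Pankowski2010] Ł. Pańkowski, Acta Arith. 141 (2010), 59–72, Theorem 1.1, Cor. 5.3.
-/

noncomputable section

open Complex

namespace Literature.NumberTheory.LFunctions

/-! ### The counting predicate and the combination -/

/-- **`N'_F(σ₁, σ₂, T) ≫ T` for all sufficiently large `T`**: there are `c > 0` and `T₀` such
that for every `T ≥ T₀` some finite set of at least `cT` (distinct) zeros of `F` lies in the
rectangle `σ₁ < Re s < σ₂`, `|Im s| ≤ T` (the lower bound for the number of zeros counted WITHOUT
multiplicity, [SaiasWeingartner2009], §1).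
[cite: SaiasWeingartner2009, §1 (definition of N'_F) and Thm. 2] -/
def HasLinearlyManyZeros (F : ℂ → ℂ) (σ₁ σ₂ : ℝ) : Prop :=
  ∃ c : ℝ, 0 < c ∧ ∃ T₀ : ℝ, ∀ T : ℝ, T₀ ≤ T →
    ∃ Z : Finset ℂ, c * T ≤ Z.card ∧ ∀ s ∈ Z, σ₁ < s.re ∧ s.re < σ₂ ∧ |s.im| ≤ T ∧ F s = 0

/-- **The linear combination `F(s) = ∑ᵢ Pᵢ(s) L(s, χᵢ)`** of Dirichlet `L`-functions with
Dirichlet-polynomial coefficients `Pᵢ(s) = ∑ₙ P i n · n^{-s}` (`LSeries (P i)`, the coefficient at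
`n = 0` being invisible). [cite: SaiasWeingartner2009, Thm. 2] -/
def charCombination {ι : Type*} [Fintype ι] {q : ι → ℕ} [∀ i, NeZero (q i)]
    (χ : ∀ i, DirichletCharacter ℂ (q i)) (P : ι → ℕ → ℂ) (s : ℂ) : ℂ :=
  ∑ i, LSeries (P i) s * (χ i).LFunction s

/-- **The hypotheses of Saias–Weingartner's Theorem 2**: "a finite set of at least two primitive
Dirichlet characters" (`2 ≤ card ι`, each `χ i` primitive of level `q i`, the pairs `⟨q i, χ i⟩`
pairwise distinct) and "a family of non-zero Dirichlet polynomials" (each `P i` finitely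
supported with some non-zero coefficient at an `n ≥ 1`). [cite: SaiasWeingartner2009, Thm. 2] -/
structure IsSWFamily {ι : Type*} [Fintype ι] {q : ι → ℕ} (χ : ∀ i, DirichletCharacter ℂ (q i))
    (P : ι → ℕ → ℂ) : Prop where
  two_le_card : 2 ≤ Fintype.card ι
  isPrimitive : ∀ i, (χ i).IsPrimitive
  injective : Function.Injective fun i ↦ (⟨q i, χ i⟩ : Σ n, DirichletCharacter ℂ n)
  finite_support : ∀ i, (Function.support (P i)).Finite
  exists_ne_zero : ∀ i, ∃ n, n ≠ 0 ∧ P i n ≠ 0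

/-! ### The right half of Theorem 2 as a named fact -/

/-- **Saias–Weingartner 2009, Theorem 2, strips to the right of `σ = 1`** (the case `σ₁ ≥ 1`,
proved in §4 from Lemmas 1–2, the Brouwer fixed point theorem, Weyl's criterion and Rouché's
theorem): for `F = ∑ᵢ Pᵢ L(·, χᵢ)` as in Theorem 2 "there exists a number `η = η(F) > 0` such
that, for all real numbers `σ₁` and `σ₂` with" `1 ≤ σ₁ < σ₂ ≤ 1 + η` "and all sufficiently large
`T`, we have `N'_F(σ₁, σ₂, T) ≫_{F,σ₁,σ₂} T`." (The complementary case `σ₁ < 1` — "Theorem 2 of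
[KK07]" — is the proved theorem `SaiasWeingartner2009_thm2_left_of_pankowski` of
`SaiasWeingartnerLeftProofs.lean`; Theorem 2 in full is `saiasWeingartner_thm2_of_pankowski`
there.)
[cite: SaiasWeingartner2009, Thm. 2 and §4 (case σ₁ ≥ 1)] -/
def SaiasWeingartner2009_thm2_right : Prop :=
  ∀ (ι : Type) [Fintype ι] (q : ι → ℕ) [∀ i, NeZero (q i)] (χ : ∀ i, DirichletCharacter ℂ (q i))
    (P : ι → ℕ → ℂ), IsSWFamily χ P →
    ∃ η : ℝ, 0 < η ∧ ∀ σ₁ σ₂ : ℝ, 1 ≤ σ₁ → σ₁ < σ₂ → σ₂ ≤ 1 + η →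
      HasLinearlyManyZeros (charCombination χ P) σ₁ σ₂

/-! ### Proved API -/

/-- Unfolding `charCombination`. [folklore] -/
theorem charCombination_apply {ι : Type*} [Fintype ι] {q : ι → ℕ} [∀ i, NeZero (q i)]
    (χ : ∀ i, DirichletCharacter ℂ (q i)) (P : ι → ℕ → ℂ) (s : ℂ) :
    charCombination χ P s = ∑ i, LSeries (P i) s * (χ i).LFunction s :=
  rfl

/-- An `IsSWFamily` has a non-empty index type. [folklore] -/
theorem IsSWFamily.nonempty {ι : Type*} [Fintype ι] {q : ι → ℕ}
    {χ : ∀ i, DirichletCharacter ℂ (q i)} {P : ι → ℕ → ℂ} (h : IsSWFamily χ P) : Nonempty ι :=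
  Fintype.card_pos_iff.1 (lt_of_lt_of_le two_pos h.two_le_card)

/-- An `IsSWFamily` has two distinct indices. [folklore] -/
theorem IsSWFamily.exists_pair_ne {ι : Type*} [Fintype ι] {q : ι → ℕ}
    {χ : ∀ i, DirichletCharacter ℂ (q i)} {P : ι → ℕ → ℂ} (h : IsSWFamily χ P) :
    ∃ i j : ι, i ≠ j :=
  Fintype.exists_pair_of_one_lt_card (lt_of_lt_of_le one_lt_two h.two_le_card)

/-- `HasLinearlyManyZeros` is monotone in the strip: zeros in `σ₁ < Re s < σ₂` are zeros in any
wider strip. [folklore] -/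
theorem HasLinearlyManyZeros.mono {F : ℂ → ℂ} {σ₁ σ₂ σ₁' σ₂' : ℝ}
    (h : HasLinearlyManyZeros F σ₁ σ₂) (h₁ : σ₁' ≤ σ₁) (h₂ : σ₂ ≤ σ₂') :
    HasLinearlyManyZeros F σ₁' σ₂' := by
  obtain ⟨c, hc, T₀, hT⟩ := h
  refine ⟨c, hc, T₀, fun T hT' ↦ ?_⟩
  obtain ⟨Z, hZ, hmem⟩ := hT T hT'
  refine ⟨Z, hZ, fun s hs ↦ ?_⟩
  obtain ⟨hs1, hs2, hs3, hs4⟩ := hmem s hs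
  exact ⟨lt_of_le_of_lt h₁ hs1, lt_of_lt_of_le hs2 h₂, hs3, hs4⟩

/-- **From discs to strips**: if for all large `T` there are at least `cT` zeros with
`|Re s − σ| < r` and `|Im s| ≤ T`, and `σ₁ ≤ σ − r`, `σ + r ≤ σ₂`, then
`HasLinearlyManyZeros F σ₁ σ₂`. [folklore] -/
theorem HasLinearlyManyZeros.of_abs_sub_lt {F : ℂ → ℂ} {σ r σ₁ σ₂ : ℝ} (h₁ : σ₁ ≤ σ - r)
    (h₂ : σ + r ≤ σ₂)
    (h : ∃ c : ℝ, 0 < c ∧ ∃ T₀ : ℝ, ∀ T : ℝ, T₀ ≤ T →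
      ∃ Z : Finset ℂ, c * T ≤ Z.card ∧ ∀ z ∈ Z, |z.re - σ| < r ∧ |z.im| ≤ T ∧ F z = 0) :
    HasLinearlyManyZeros F σ₁ σ₂ := by
  obtain ⟨c, hc, T₀, hT⟩ := h
  refine ⟨c, hc, T₀, fun T hT' ↦ ?_⟩
  obtain ⟨Z, hZ, hmem⟩ := hT T hT'
  refine ⟨Z, hZ, fun s hs ↦ ?_⟩
  obtain ⟨hs1, hs2, hs3⟩ := hmem s hs
  obtain ⟨hl, hu⟩ := abs_lt.1 hs1
  exact ⟨by linarith, by linarith, hs2, hs3⟩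

/-- **Glue for Theorem 2 along the first sentence of §4** ("If `σ₁ < 1` then
`N'_F(σ₁, σ₂, T) ≫ T` by Theorem 2 of [KK07]. We may thus restrict our attention to the case
`σ₁ ≥ 1`"): if `F` has `≫ T` zeros in every strip with `1/2 ≤ σ₁ < σ₂ ≤ 1` and in every strip
with `1 ≤ σ₁ < σ₂ ≤ 1 + η`, then in every strip with `1/2 ≤ σ₁ < σ₂ ≤ 1 + η` — a strip with
`σ₁ < 1` contains the strip `σ₁ < Re s < min(σ₂, 1)`. (The in-tree instance is
`saiasWeingartner_thm2_of_pankowski` in `SaiasWeingartnerLeftProofs.lean`, which performs this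
case split with `hl := SaiasWeingartner2009_thm2_left_of_pankowski hU ι q χ P hF` and `hr` from
`SaiasWeingartner2009_thm2_right`.) [cite: SaiasWeingartner2009, §4 (first sentence)] -/
theorem saiasWeingartner_thm2_of_halves {F : ℂ → ℂ} {η : ℝ}
    (hl : ∀ σ₁ σ₂ : ℝ, 1 / 2 ≤ σ₁ → σ₁ < σ₂ → σ₂ ≤ 1 → HasLinearlyManyZeros F σ₁ σ₂)
    (hr : ∀ σ₁ σ₂ : ℝ, 1 ≤ σ₁ → σ₁ < σ₂ → σ₂ ≤ 1 + η → HasLinearlyManyZeros F σ₁ σ₂)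
    {σ₁ σ₂ : ℝ} (h₁ : 1 / 2 ≤ σ₁) (h₁₂ : σ₁ < σ₂) (h₂ : σ₂ ≤ 1 + η) :
    HasLinearlyManyZeros F σ₁ σ₂ := by
  rcases lt_or_ge σ₁ 1 with hσ | hσ
  · exact (hl σ₁ (min σ₂ 1) h₁ (lt_min h₁₂ hσ) (min_le_right _ _)).mono le_rfl (min_le_left _ _)
  · exact hr σ₁ σ₂ hσ h₁₂ h₂

end Literature.NumberTheory.LFunctions
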